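import Summits.ResolutionOfSingularities.ResolutionOfSingularities.Theorems.HomologicalConductorNoZenoBaseIdealCartier
import Summits.ResolutionOfSingularities.ResolutionOfSingularities.Theorems.HomologicalConductorNoZenoBaseIdealSections
import Summits.ResolutionOfSingularities.ResolutionOfSingularities.Theorems.HomologicalConductorNoZenoExcDegreeAvoids
import HarnessLib

/-!
# Crux `NoZenoR` (stmt-ResolutionOfSingularities-19943), slot `stub_L1wCoreF3`, (B1) split core STEP 3 (1) BY NAME:
# `P = {E : (Z·E) < 0} ≠ ∅` for the exceptional cycle `Z` of an `𝔪`-primary base ideal principalised on the fibre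

Route `ResolutionOfSingularities/HomologicalConductor`.  OURS (cell res-hironaka, crux chain W4.4, lead seat
res-L0-w44-lead-1 g8, memo `B1-CENSUS-g8.md`); nothing here is a statement of the manuscript under review (Hironaka
2017); AI-written, weaker than expert review.

The composition of the lead's (B1) bricks `…NoZenoExcDegreeNonzero` (UP-1′, p553686), `…NoZenoExcDegreeAvoids`
(sign, p554806), `…NoZenoBaseIdealCartier` (the cycle `Z` of `𝔞𝒪_X`, p561517) and `…NoZenoBaseIdealSections` (`hgen`):
for a resolution `π : X → Spec T` of a two-dimensional normal Noetherian local domain with `H¹(X, 𝒪_X) = 0`, and an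
ideal `𝔞` with `𝔪ᶜ ≤ 𝔞 ≤ 𝔪`, `𝔞 ≠ 0`, such that `𝔞·𝒪_(X,x)` is principal wherever the structure map is local (the
clause of `ExcCount.IsSepX1Sandwiched`), the exceptional cycle `Z := CartierDivisor.ofIsEffectiveCartier (𝔞𝒪_X)`
satisfies: `Z` is anti-nef (`(Z·E) ≤ 0` for every integral exceptional curve) and **`(Z·E_η) < 0` for some `η`**
— granting `Lipman1969_12_1_i` (a conjunct of the registry's facts prefix).  No other hypothesis: this is STEP 3 (1)
of the (B1) split core in by-name form.

* `excCurveDegree_baseIdealDivisor_nonpos` — anti-nefness of `Z`;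
* `exists_excCurveDegree_baseIdealDivisor_neg` — `P ≠ ∅`.

References: J. Lipman, Publ. Math. IHÉS 36 (1969), Thm. (12.1) (i) (p. 220) [`Lipman1969`]; res-L0-w44-stub-2 (L1)-PREP
v2 §2 STEP 3 (1) (OURS).
-/

noncomputable section

-- single-problem summit: the doubled namespace component `ResolutionOfSingularities` is forced
set_option linter.dupNamespace false

namespace Summit.ResolutionOfSingularities.ResolutionOfSingularities.Theorems.NoZeno.ExcCount

open CategoryTheory AlgebraicGeometry TopologicalSpace IsLocalRing
open Literature.AlgebraicGeometry Literature.AlgebraicGeometry.Resolution Literature.AlgebraicGeometry.Motives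

variable {T : Type} [CommRing T] [IsLocalRing T] [IsDomain T] [IsNoetherianRing T] [IsIntegrallyClosed T]
  {X : Scheme.{0}} [IsIntegral X] [IsLocallyNoetherian X] {π : X ⟶ Spec (.of T)}

omit [IsDomain T] [IsNoetherianRing T] [IsIntegrallyClosed T] in
/-- **The exceptional cycle of a base ideal is anti-nef**: `(Z·E_η) ≤ 0` for every integral exceptional curve, `Z`
the Cartier divisor of `𝔞𝒪_X` (each `η` carries an element of `𝔞` generating `𝒪_X(−Z)` there).
[cite: Lipman1969, Section 12, Remark 2 c) (p. 221)] -/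
theorem excCurveDegree_baseIdealDivisor_nonpos [IsProper π] {𝔞 : Ideal T}
    (hJ : IsEffectiveCartier (Scheme.IdealSheafData.ofIdealTop (𝔞.map (Morphisms.algebraMapΓ π))))
    {η : X} (hη : η ∈ excCurvePoints π) :
    excCurveDegree π (CartierDivisor.ofIsEffectiveCartier _ hJ) η ≤ 0 := by
  obtain ⟨s, hs, hηs⟩ := forall_exists_isSection_nonvanishing_neg_baseIdealDivisor π hJ η
  exact excCurveDegree_nonpos_of_isSection_neg π hη _ hs hηs

/-- **STEP 3 (1) BY NAME — `P ≠ ∅`.**  For a resolution `π : X → Spec T` of a two-dimensional normal Noetherian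
local domain with `H¹(X, 𝒪_X) = 0` and an ideal `𝔞 ≠ 0` with `𝔪ᶜ ≤ 𝔞 ≤ 𝔪` whose extension `𝔞·𝒪_(X,x)` is principal
at every point where `T → 𝒪_(X,x)` is local: the base ideal sheaf `𝔞𝒪_X` is an effective Cartier divisor and, granting
Lipman (12.1) (i), its divisor `Z` has `(Z·E_η) < 0` for some integral exceptional curve `E_η`.
[cite: Lipman1969, Theorem (12.1) (i) (p. 220)] -/
theorem exists_excCurveDegree_baseIdealDivisor_neg (h121 : Lipman1969_12_1_i.{0}) (hdim : ringKrullDim T = 2)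
    (hπ : IsResolution π) (hH1 : HasTrivialCechH1 π) {𝔞 : Ideal T} (h𝔞0 : 𝔞 ≠ ⊥) {c : ℕ}
    (hc : maximalIdeal T ^ c ≤ 𝔞) (h𝔞 : 𝔞 ≤ maximalIdeal T)
    (hprin : ∀ x : X, IsLocalHom (toStalk π x) → (𝔞.map (toStalk π x)).IsPrincipal) :
    ∃ hJ : IsEffectiveCartier (Scheme.IdealSheafData.ofIdealTop (𝔞.map (Morphisms.algebraMapΓ π))),
      ∃ η ∈ excCurvePoints π, excCurveDegree π (CartierDivisor.ofIsEffectiveCartier _ hJ) η < 0 := by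
  haveI : IsProper π := hπ.isProper
  haveI : IsDominant π := hπ.isBirational.isDominant
  have hJ := isEffectiveCartier_baseIdeal π h𝔞0 hc hprin
  refine ⟨hJ, exists_excCurveDegree_neg_of_forall_isSection_neg h121 hdim hπ hH1 _
    (baseIdealDivisor_isEffective π hJ) (fun x hx => baseIdealDivisor_avoids_of_base_ne π hJ hc h𝔞 hx)
    (exists_not_avoids_baseIdealDivisor π hJ hc h𝔞)
    (fun η _ => forall_exists_isSection_nonvanishing_neg_baseIdealDivisor π hJ η)⟩

end Summit.ResolutionOfSingularities.ResolutionOfSingularities.Theorems.NoZeno.ExcCount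

end
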